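import Literature.NumberTheory.GaloisRepresentations.IdeleProjection
import Literature.NumberTheory.GaloisRepresentations.PresentationOfFiniteGaloisModule
import Literature.NumberTheory.GaloisRepresentations.HomDualPresentation
import Literature.NumberTheory.GaloisRepresentations.SpectralOrdQ
import HarnessLib

/-!
# The idèle ASSEMBLY (R3) for THE idèle projections: a compatible family of local equivariant homomorphisms
# `h_v : X → K̄_vˣ`, unit-valued off a finite set, is `(π_v ∘ f)_v` for one `C_Γ`-morphism `f : X ⟶ J̄`
# (Milne ADT I Lemma 4.13; door-c6 g17 FINDING §2, hypothesis `hAsm`, DISCHARGED)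

Topic `NumberTheory/GaloisRepresentations`; namespace `Literature.NumberTheory.GaloisRepresentations.IdeleReadout`.
Theorems only (no definition, no named fact, no instance, no notation, no `sorry`); number fields in `Type`.

THE POINT.  Door-c6 g17's `poitouTate_selmerStructure_duality_of_assembly inv hT π hAsm hR4` (Summits,
`…PoitouTatePresentationReadout`) takes an idèle projection family `π : ∀ v, HomDual.IdeleProjection K v` and the ASSEMBLY
hypothesis `hAsm`: for the kernel `N₁ = (presentationComplex ρ₀).X₁` of the canonical presentation of a finite Galois
module, every family `h = (h_v)_v` of invariants `h_v ∈ Hom_ℤ(N₁|_v, K̄_vˣ)^{Γ_{K_v}}` whose finite members off `T` are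
unit-valued (`ordQ ∘ h_v = 0`) is `(readoutInvariant (π v) N₁ f)_v` for ONE `f : N₁ ⟶ J̄`.  For door-c5 g17's projections
`π = ideleProjection K` (previous file) this IS door-c5 g17's layer assembly `exists_ideleBarD_hom_of_localHoms`
(`IdeleBarHomOfLocalHoms`: descend `X` to the `Gal(E/K)`-module `N₁` for a trivialising layer `E`, assemble
`N₁ ⟶ J_E = J_{E,fin} × E_∞ˣ` place by place from the `D_{w_v}`-morphisms `N₁ → E_{w_v}ˣ` read off `h_v` through
`placeEmb`, lift to `J̄` by `ofLayerHom`), read through the bridge `π_v ∘ f = π_v^{E} ∘ layerLift E f`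
(`finIdelePi_layerLift`, `archIdelePi_layerLift`) and the currency lemmas `HomDual.mem_invariants_iff`
(invariant = equivariant), `ordQ_eq_zero_iff` (`ord = 0 ↔ ‖·‖ = 1`).

* **`exists_hom_readoutInvariant_eq`** — the assembly for any `X : C_Γ` of finite type trivialised by a layer `E`;
* **`ideleAssembly`** — VERBATIM the hypothesis `hAsm` of `poitouTate_selmerStructure_duality_of_assembly` for
  `π := ideleProjection K` (layer `presentationLayer ρ₀ = K(M)`, `presentationComplex_X₁_trivial`).

HONEST FRAMING: with (R-def) and (R3) = `hAsm` discharged, door-c6's road gives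
`poitouTate_selmerStructure_duality K` from door-c4's Tate-duality record and the pairing dictionary (R4) ALONE (next
file, Summits); no case of Poitou–Tate or BSD is proved here.

## References
* J. S. Milne, *Arithmetic Duality Theorems* (2nd ed. 2006), I Lemma 4.13 (proof), I §0 (0.8). [MilneADT2006]
* J. W. S. Cassels, A. Fröhlich (eds.), *Algebraic Number Theory* (1967), Ch. VII (Tate) §8 Prop. 8.1, §9.7. [CasselsFrohlichANT1967]
* D. Harari, *Galois Cohomology and Class Field Theory* (2020), §13.1. [Harari2020]
-/

noncomputable section

open NumberField NumberField.InfinitePlace IsDedekindDomain Field CategoryTheory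
open Literature.NumberTheory.Automorphic

namespace Literature.NumberTheory.GaloisRepresentations

namespace IdeleReadout

open SemiLocal ArchHerbrand DiscreteGaloisModule IdeleClassBar HomDual DGMBridge FreePresentation
  Literature.Algebra.Homology Literature.Algebra.Homology.DiscreteRep

variable {K : Type} [Field K] [NumberField K]

/-- **The idèle assembly for THE idèle projections** (Milne I Lemma 4.13): for an object `X` of `C_Γ` of finite type on
which a layer `U_E` acts trivially, every family of invariants `h_v ∈ Hom_ℤ(X|_v, K̄_vˣ)^{Γ_{K_v}}` (`v` ranging over
ALL places) whose finite members off `T` are unit-valued is `(π_v ∘ f)_v` for one `f : X ⟶ J̄`.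
[cite: MilneADT2006, I Lemma 4.13 (proof)] [cite: CasselsFrohlichANT1967, Ch. VII §8 Prop. 8.1] -/
theorem exists_hom_readoutInvariant_eq (X : DiscreteRepCat ℤ (absoluteGaloisGroup K)) [Module.Finite ℤ (LCarrier X)]
    (E : GalLayer K) (hX : ∀ σ ∈ E.openNormalSubgroup, ∀ x : X.obj.V, X.obj.ρ σ x = x) (T : Finset (Place K))
    (h : ∀ v : Place K,
      (homGaloisModule ((toDGM X).restrictField (Place.Completion v)) (units (Place.Completion v))).toTopRep.ρ.invariants)
    (hunit : ∀ v : HeightOneSpectrum (𝓞 K), (Sum.inr v : Place K) ∉ T → ∀ x : LCarrier X,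
      IsNonarchimedeanLocalField.ordQ (v.adicCompletion K)
        ((show LCarrier X →ₗ[ℤ] UnitsCarrier (v.adicCompletion K) from
          ((h (Sum.inr v)).1 : DiscreteRep.HomCarrier (LCarrier X) (UnitsCarrier (v.adicCompletion K)))) x) = 0) :
    ∃ f : X ⟶ ideleBarD K, ∀ v : Place K, readoutInvariant (ideleProjection K v) X f = h v := by
  classical
  -- the local data in door-c5's currency
  let hfin : ∀ v : HeightOneSpectrum (𝓞 K), X.obj.V →+ UnitsCarrier (v.adicCompletion K) := fun v =>
    (show LCarrier X →ₗ[ℤ] UnitsCarrier (v.adicCompletion K) from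
      ((h (Sum.inr v)).1 : DiscreteRep.HomCarrier (LCarrier X) (UnitsCarrier (v.adicCompletion K)))).toAddMonoidHom.comp
      (LCarrier.of X)
  let hinf : ∀ v : InfinitePlace K, X.obj.V →+ UnitsCarrier v.Completion := fun v =>
    (show LCarrier X →ₗ[ℤ] UnitsCarrier v.Completion from
      ((h (Sum.inl v)).1 : DiscreteRep.HomCarrier (LCarrier X) (UnitsCarrier v.Completion))).toAddMonoidHom.comp
      (LCarrier.of X)
  have hfinEq : ∀ v : HeightOneSpectrum (𝓞 K), IsPlaceLocalHom X v (hfin v) := fun v d x => by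
    have key := (mem_invariants_iff ((toDGM X).restrictField (Place.Completion (Sum.inr v : Place K)))
      (units (Place.Completion (Sum.inr v : Place K))) (h (Sum.inr v)).1).1 (h (Sum.inr v)).2 d (LCarrier.of X x)
    rw [GaloisRep.restrictField_apply, toDGM_apply, LCarrier.val_of] at key
    exact key
  have hinfEq : ∀ v : InfinitePlace K, IsInfPlaceLocalHom X v (hinf v) := fun v d x => by
    have key := (mem_invariants_iff ((toDGM X).restrictField (Place.Completion (Sum.inl v : Place K)))
      (units (Place.Completion (Sum.inl v : Place K))) (h (Sum.inl v)).1).1 (h (Sum.inl v)).2 d (LCarrier.of X x)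
    rw [GaloisRep.restrictField_apply, toDGM_apply, LCarrier.val_of] at key
    exact key
  let T' : Finset (HeightOneSpectrum (𝓞 K)) := T.preimage Sum.inr (Sum.inr_injective.injOn)
  have hunit' : ∀ v : HeightOneSpectrum (𝓞 K), v ∉ T' → ∀ x : X.obj.V,
      IsNonarchimedeanLocalField.algNorm (v.adicCompletion K)
        (unitsVal (v.adicCompletion K) (hfin v x) : AlgebraicClosure (v.adicCompletion K)) = 1 := fun v hv x => by
    have hv' : (Sum.inr v : Place K) ∉ T := fun hvT => hv (Finset.mem_preimage.mpr hvT)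
    exact (IsNonarchimedeanLocalField.ordQ_eq_zero_iff (v.adicCompletion K) _).1 (hunit v hv' (LCarrier.of X x))
  obtain ⟨f, hf, hf'⟩ := exists_ideleBarD_hom_of_localHoms E hX T' (hfin := hfin) hfinEq hunit' (hinf := hinf) hinfEq
  refine ⟨f, fun v => Subtype.ext (LinearMap.ext fun x => ?_)⟩
  rw [coe_readoutInvariant, readoutMap_apply]
  rcases v with w | v
  · change archIdelePi w (f.hom.hom (LCarrier.val X x)) = _
    rw [archIdelePi_layerLift w E hX f]
    exact hf' w (LCarrier.val X x)
  · change finIdelePi v (f.hom.hom (LCarrier.val X x)) = _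
    rw [finIdelePi_layerLift v E hX f]
    exact hf v (LCarrier.val X x)

/-- **`hAsm` DISCHARGED**: verbatim the assembly hypothesis of door-c6 g17's
`poitouTate_selmerStructure_duality_of_assembly` (Summits `…PoitouTatePresentationReadout`) for the idèle projections
`π := ideleProjection K` — for the kernel `N₁` of the canonical presentation of any finite Galois module `ρ₀`
(trivialising layer `K(M) = presentationLayer ρ₀`). [cite: MilneADT2006, I Lemma 4.13 (proof), I Lemma 1.9 (proof)] -/
theorem ideleAssembly :
    ∀ (n : ℕ) [NeZero n],
      ∀ ⦃M : Type⦄ [AddCommGroup M] [TopologicalSpace M] [DiscreteTopology M] [Finite M] [Finite (TateDual K M n)]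
      (ρ₀ : DiscreteGaloisModule K M) (_hM : ∀ m : M, n • m = 0),
      ∀ (T : Finset (Place K))
        (h : ∀ v : Place K, (haveI := moduleFinite_presModule₁ ρ₀
          (homGaloisModule ((presModule₁ ρ₀).restrictField (Place.Completion v))
            (DiscreteGaloisModule.units (Place.Completion v))).toTopRep.ρ.invariants)),
        (∀ v : HeightOneSpectrum (𝓞 K), (Sum.inr v : Place K) ∉ T → ∀ x : LCarrier (presentationComplex ρ₀).X₁,
          IsNonarchimedeanLocalField.ordQ (v.adicCompletion K)
            ((show LCarrier (presentationComplex ρ₀).X₁ →ₗ[ℤ] DiscreteGaloisModule.UnitsCarrier (v.adicCompletion K) from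
              ((h (Sum.inr v)).1 : DiscreteRep.HomCarrier (LCarrier (presentationComplex ρ₀).X₁)
                (DiscreteGaloisModule.UnitsCarrier (v.adicCompletion K)))) x) = 0) →
        ∃ f : (presentationComplex ρ₀).X₁ ⟶ (ideleClassLimitShortComplex K).X₂, ∀ v : Place K,
          (haveI := moduleFinite_presModule₁ ρ₀; readoutInvariant (ideleProjection K v) (presentationComplex ρ₀).X₁ f) =
            h v := by
  intro n _ M _ _ _ _ _ ρ₀ _ T h hunit
  haveI := moduleFinite_presModule₁ ρ₀
  exact exists_hom_readoutInvariant_eq (presentationComplex ρ₀).X₁ (presentationLayer ρ₀)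
    (presentationComplex_X₁_trivial ρ₀) T h hunit

/-- The same for a single finite Galois module (no torsion exponent needed). [cite: MilneADT2006, I Lemma 4.13 (proof)] -/
theorem exists_presentation_hom_readoutInvariant_eq {M : Type} [AddCommGroup M] [TopologicalSpace M]
    [DiscreteTopology M] [Finite M] (ρ₀ : DiscreteGaloisModule K M) (T : Finset (Place K))
    (h : ∀ v : Place K, (haveI := moduleFinite_presModule₁ ρ₀
      (homGaloisModule ((presModule₁ ρ₀).restrictField (Place.Completion v))
        (DiscreteGaloisModule.units (Place.Completion v))).toTopRep.ρ.invariants))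
    (hunit : ∀ v : HeightOneSpectrum (𝓞 K), (Sum.inr v : Place K) ∉ T → ∀ x : LCarrier (presentationComplex ρ₀).X₁,
      IsNonarchimedeanLocalField.ordQ (v.adicCompletion K)
        ((show LCarrier (presentationComplex ρ₀).X₁ →ₗ[ℤ] DiscreteGaloisModule.UnitsCarrier (v.adicCompletion K) from
          ((h (Sum.inr v)).1 : DiscreteRep.HomCarrier (LCarrier (presentationComplex ρ₀).X₁)
            (DiscreteGaloisModule.UnitsCarrier (v.adicCompletion K)))) x) = 0) :
    ∃ f : (presentationComplex ρ₀).X₁ ⟶ ideleBarD K, ∀ v : Place K,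
      (haveI := moduleFinite_presModule₁ ρ₀; readoutInvariant (ideleProjection K v) (presentationComplex ρ₀).X₁ f) = h v := by
  haveI := moduleFinite_presModule₁ ρ₀
  exact exists_hom_readoutInvariant_eq (presentationComplex ρ₀).X₁ (presentationLayer ρ₀)
    (presentationComplex_X₁_trivial ρ₀) T h hunit

end IdeleReadout

end Literature.NumberTheory.GaloisRepresentations

end
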